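import Literature.Geometry.Symplectic.PALFInwardFields
import Literature.Topology.FourManifolds.BoundaryLevelLift
import Literature.Topology.FourManifolds.BorderedEhresmannLevel
import Literature.Topology.FourManifolds.CollarTheorem
import HarnessLib

/-!
# The product structure of a PALF over a box, compatible with a collar coordinate

Topic `Literature/Geometry/Symplectic` (fact seat
`provefact-Literature.Geometry.Symplectic.Oba2016_s-add47373d4`; Kas' handle count for a
Lefschetz fibration over the disc — Kas 1980, Gompf–Stipsicz 1999 §8.2, Oba 2016 §2.2 — needs
the product structure `f⁻¹(Q) ≅ Q × F` near the horizontal boundary `Q × ∂F` to preserve a collar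
coordinate `σ` of `∂W`, so that a collar-shaped function of the fibre extends `σ`-compatibly).
Everything is proved; no definitions, no named facts.

For a PALF `P : PALF o b` on the compact `W⁴` and a flow-out input `D`
(`Literature.Topology.FourManifolds.FlowoutInput`: `σ = D.f ≥ 0` smooth, `= 0` exactly on `∂W`, with a field `D.ξ`,
`dσ(D.ξ) = 1` near `∂W`; it exists, `Literature.Topology.FourManifolds.nonempty_flowoutInput`):

* §1 `mlineDeriv_pos_of_inward_of_forall_le'` — at a boundary point a strictly inward vector
  has `dσ > 0`; `exists_pos_forall_mlineDeriv_kernelField_pos` — for the kernel field `ν` of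
  `PALF.exists_kernel_field_inward` there is `s₁ > 0` with `dσ(ν) > 0` on
  `{‖f‖ ≤ r} ∩ {σ < s₁}` (compactness);
* §2 `exists_trivialisation_of_box_level` — **the product structure over a box preserving the
  collar levels**: for a closed `Δ`-box inside the disc of radius `r < 1` without critical
  values there are `s₀ > 0` and smooth `Φ`, `Ψ` with all the properties of
  `PALF.exists_trivialisation_of_box` and moreover `σ (Φ (u, y)) = σ y`, `σ (Ψ x) = σ x` below the
  level `s₀` (lifts from `Literature.Topology.FourManifolds.exists_contMDiff_lift_tangent_level`, folds and first
  integrals from `Literature.Topology.FourManifolds.exists_trivialisation_of_fields`).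

## References

* A. Kas, *On the handlebody decomposition associated to a Lefschetz fibration*, Pacific J.
  Math. 89 (1980), §1. [Kas1980]
* R. E. Gompf, A. I. Stipsicz, *4-Manifolds and Kirby Calculus*, GSM 20 (1999), §8.2.
  [GompfStipsiczGSM1999]
* Th. Bröcker, K. Jänich, *Introduction to Differential Topology*, CUP 1982, (8.12).
  [BrockerJanichIDT1982]
-/

open scoped Manifold ContDiff Topology
open Set Function Filter

noncomputable section

namespace Literature.Geometry.Symplectic

open Literature.Topology.FourManifolds

universe u

variable {W : Type u} [TopologicalSpace W] [ChartedSpace (EuclideanHalfSpace 4) W]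
  [IsManifold (𝓡∂ 4) ∞ W]

/-! ### §1 The collar coordinate along inward vectors -/

/-- **At a boundary point, a strictly inward vector has `dσ > 0`** for a function `σ`
minimal on the boundary point and regular there
(`Literature.Topology.FourManifolds.mlineDeriv_neg_of_forall_le_of_mem_boundary` for `-σ`). [folklore] -/
theorem mlineDeriv_pos_of_inward_of_forall_le' {n : ℕ} {M : Type u} [TopologicalSpace M]
    [ChartedSpace (EuclideanHalfSpace (n + 1)) M] [IsManifold (𝓡∂ (n + 1)) ∞ M]
    {σ : M → ℝ} {x : M} (hσ : MDifferentiableAt (𝓡∂ (n + 1)) 𝓘(ℝ, ℝ) σ x)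
    (hle : ∀ y, σ x ≤ σ y) (hx : x ∈ (𝓡∂ (n + 1)).boundary M)
    (hncrit : ¬ IsMCriticalPt (𝓡∂ (n + 1)) σ x) {v : TangentSpace (𝓡∂ (n + 1)) x}
    (hv : 0 < halfSpaceCoord n v) : 0 < mlineDeriv (𝓡∂ (n + 1)) σ x v := by
  have hle' : ∀ y, (-σ) y ≤ (-σ) x := fun y => by simp only [Pi.neg_apply]; linarith [hle y]
  have hncrit' : ¬ IsMCriticalPt (𝓡∂ (n + 1)) (-σ) x := by
    intro h
    apply hncrit
    unfold IsMCriticalPt at h ⊢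
    rw [mfderiv_neg] at h
    exact neg_eq_zero.1 h
  have h := mlineDeriv_neg_of_forall_le_of_mem_boundary hσ.neg hle' hx hncrit' hv
  have key : mlineDeriv (𝓡∂ (n + 1)) (-σ) x v = -(mlineDeriv (𝓡∂ (n + 1)) σ x v) := by
    simp only [mlineDeriv_def, mfderiv_neg]; rfl
  rw [key] at h
  linarith

variable {o : SmoothOrientation (𝓡∂ 4) W} {b : BoundaryData (𝓡∂ 4) W (𝓡 3)} (P : PALF o b)

namespace PALF

/-- The collar coordinate of a flow-out input is regular at the boundary. [folklore] -/
theorem not_isMCriticalPt_flowout (D : FlowoutInput 3 W) {x : W} (hx : x ∈ (𝓡∂ 4).boundary W) :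
    ¬ IsMCriticalPt (𝓡∂ 4) D.f x := by
  intro h
  have h1 := D.mlineDeriv_f_ξ x (by rw [(D.f_eq_zero_iff x).2 hx]; exact D.δ_pos.le)
  unfold IsMCriticalPt at h
  rw [mlineDeriv_def, h] at h1
  have h2 : (0 : ℝ) = 1 := h1
  exact zero_ne_one h2

variable [T2Space W] [CompactSpace W]

omit [T2Space W] in
/-- **The kernel field is transverse to the collar levels near the horizontal boundary.**
For the field `ν` of `PALF.exists_kernel_field_inward` (in `ker df` over `{‖f‖ ≤ r}`, strictly
inward at the boundary points there) and a flow-out input `D`, there is `s₁ > 0` with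
`dσ(ν x) > 0` whenever `‖f x‖ ≤ r` and `σ x < s₁` (at the boundary by
`mlineDeriv_pos_of_inward_of_forall_le'`, nearby by compactness). [cite: Kas1980, §1] -/
theorem exists_pos_forall_mlineDeriv_pos (D : FlowoutInput 3 W) {r : ℝ}
    {ν : Π x : W, TangentSpace (𝓡∂ 4) x}
    (hνs : ContMDiff (𝓡∂ 4) (𝓡∂ 4).tangent ∞ (fun x => (⟨x, ν x⟩ : TangentBundle (𝓡∂ 4) W)))
    (hνin : ∀ x, ‖P.f x‖ ≤ r → x ∈ (𝓡∂ 4).boundary W → 0 < halfSpaceCoord 3 (ν x)) :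
    ∃ s₁ : ℝ, 0 < s₁ ∧ ∀ x, ‖P.f x‖ ≤ r → D.f x < s₁ → 0 < mlineDeriv (𝓡∂ 4) D.f x (ν x) := by
  set ψ : W → ℝ := fun x => mlineDeriv (𝓡∂ 4) D.f x (ν x) with hψ
  have hψc : Continuous ψ := (contMDiff_mlineDeriv_section D.f_smooth hνs).continuous
  have hbd : ∀ x, ‖P.f x‖ ≤ r → x ∈ (𝓡∂ 4).boundary W → 0 < ψ x := by
    intro x hx hxb
    have hle : ∀ y, D.f x ≤ D.f y := fun y => by
      rw [(D.f_eq_zero_iff x).2 hxb]; exact D.f_nonneg y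
    exact mlineDeriv_pos_of_inward_of_forall_le' ((D.f_smooth x).mdifferentiableAt (by simp)) hle hxb
      (not_isMCriticalPt_flowout D hxb) (hνin x hx hxb)
  set A : Set W := {x | ‖P.f x‖ ≤ r ∧ ψ x ≤ 0} with hA
  have hAc : IsClosed A :=
    (isClosed_le (continuous_norm.comp P.contMDiff.continuous) continuous_const).inter
      (isClosed_le hψc continuous_const)
  by_cases hAe : A = ∅
  · refine ⟨1, one_pos, fun x hx _ => ?_⟩
    by_contra h
    have : x ∈ A := ⟨hx, not_lt.1 h⟩
    rw [hAe] at this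
    exact this
  · obtain ⟨x₀, hx₀A, hx₀min⟩ := hAc.isCompact.exists_isMinOn (nonempty_iff_ne_empty.2 hAe)
      D.f_smooth.continuous.continuousOn
    have hx₀b : x₀ ∉ (𝓡∂ 4).boundary W := fun hb => absurd hx₀A.2 (not_le.2 (hbd x₀ hx₀A.1 hb))
    have hs₁ : 0 < D.f x₀ :=
      lt_of_le_of_ne (D.f_nonneg x₀) (fun h => hx₀b ((D.f_eq_zero_iff x₀).1 h.symm))
    refine ⟨D.f x₀, hs₁, fun x hx hxs => ?_⟩
    by_contra h
    have hxA : x ∈ A := ⟨hx, not_lt.1 h⟩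
    exact (not_le.2 hxs) (hx₀min hxA)

/-! ### §2 The product structure preserving the collar levels -/

/-- **The product structure of a PALF over a box of regular values, preserving the levels of a
collar coordinate near the horizontal boundary.**  Let `P` be a PALF of the compact `W`, `D` a
flow-out input (`σ = D.f`), `c₀ ∈ ℝ²`, `δ ≤ Δ`, `r < 1`, such that the closed box
`K̂ = {u | ∀ i, |u i - c₀ i| ≤ Δ}` lies in the disc of radius `r` and contains no critical
value.  Then there are `s₀ > 0` and smooth `Φ : ℝ² × W → W`, `Ψ : W → W` with, for
`Q = {u | ∀ i, |u i - c₀ i| < δ}` and `F = f⁻¹(c₀)`: `Φ (c₀, y) = y`; `f (Φ (u, y)) = u`,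
`Ψ (Φ (u, y)) = y` (`y ∈ F`, `u ∈ Q`); `f (Ψ x) = c₀`, `Φ (f x, Ψ x) = x` (`f x ∈ Q`);
`Φ (u, y) ∈ ∂W ↔ y ∈ ∂W`, `Ψ x ∈ ∂W ↔ x ∈ ∂W`; and **`σ (Φ (u, y)) = σ y` for `y ∈ F`, `σ y < s₀`,
`u ∈ Q`, `σ (Ψ x) = σ x` for `f x ∈ Q`, `σ x < s₀`** — the trivialisation restricts to a product
of `Q` with the collar `{σ < s₀}` of `∂F` in `F`. [cite: Kas1980, §1] [cite: GompfStipsiczGSM1999, §8.2]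
[cite: BrockerJanichIDT1982, (8.12)] -/
theorem exists_trivialisation_of_box_level (D : FlowoutInput 3 W) {c₀ : EuclideanSpace ℝ (Fin 2)}
    {δ Δ r : ℝ} (hδΔ : δ ≤ Δ) (hr : r < 1)
    (hΔ : ∀ u : EuclideanSpace ℝ (Fin 2), (∀ i, |u i - c₀ i| ≤ Δ) → ‖u‖ ≤ r)
    (hcrit : ∀ p ∈ P.crit, ∃ i, Δ < |P.f p i - c₀ i|) :
    ∃ s₀ : ℝ, 0 < s₀ ∧ ∃ (Φ : EuclideanSpace ℝ (Fin 2) × W → W) (Ψ : W → W),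
      ContMDiff (𝓘(ℝ, EuclideanSpace ℝ (Fin 2)).prod (𝓡∂ 4)) (𝓡∂ 4) ∞ Φ ∧
      ContMDiff (𝓡∂ 4) (𝓡∂ 4) ∞ Ψ ∧
      (∀ y, Φ (c₀, y) = y) ∧
      (∀ y, P.f y = c₀ → ∀ u : EuclideanSpace ℝ (Fin 2), (∀ i, |u i - c₀ i| < δ) →
        P.f (Φ (u, y)) = u ∧ Ψ (Φ (u, y)) = y) ∧
      (∀ x, (∀ i, |P.f x i - c₀ i| < δ) → P.f (Ψ x) = c₀ ∧ Φ (P.f x, Ψ x) = x) ∧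
      (∀ u y, Φ (u, y) ∈ (𝓡∂ 4).boundary W ↔ y ∈ (𝓡∂ 4).boundary W) ∧
      (∀ x, Ψ x ∈ (𝓡∂ 4).boundary W ↔ x ∈ (𝓡∂ 4).boundary W) ∧
      (∀ y, P.f y = c₀ → D.f y < s₀ → ∀ u : EuclideanSpace ℝ (Fin 2), (∀ i, |u i - c₀ i| < δ) →
        D.f (Φ (u, y)) = D.f y) ∧
      ∀ x, (∀ i, |P.f x i - c₀ i| < δ) → D.f x < s₀ → D.f (Ψ x) = D.f x := by
  have hΔ1 : ∀ u : EuclideanSpace ℝ (Fin 2), (∀ i, |u i - c₀ i| ≤ Δ) → ‖u‖ < 1 :=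
    fun u hu => lt_of_le_of_lt (hΔ u hu) hr
  -- the kernel field and the level `s₁`
  obtain ⟨ν, hνs, -, hνk, hνin⟩ := P.exists_kernel_field_inward hr
  obtain ⟨s₁, hs₁, hs₁ν⟩ := P.exists_pos_forall_mlineDeriv_pos D hνs hνin
  set s₀ : ℝ := s₁ / 4 with hs₀
  have hs₀pos : 0 < s₀ := by positivity
  -- the closed sets
  set C : Set W := {x | ∀ i, |P.f x i - c₀ i| ≤ Δ} with hC
  have hCc : IsClosed C := isClosed_setOf_forall_abs_apply_sub_le P.contMDiff.continuous c₀ Δ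
  set Dl : Set W := C ∩ {x | D.f x ≤ 2 * s₀} with hDl
  have hDlc : IsClosed Dl := hCc.inter (isClosed_le D.f_smooth.continuous continuous_const)
  have hσb : ∀ y ∈ (𝓡∂ 4).boundary W, D.f y = 0 := fun y hy => (D.f_eq_zero_iff y).2 hy
  -- joint surjectivity of `(df, dσ)` on `Dl`
  have hjoint : ∀ x ∈ Dl, ∀ p : EuclideanSpace ℝ (Fin 2) × ℝ, ∃ v : EuclideanSpace ℝ (Fin 4),
      mfderiv (𝓡∂ 4) 𝓘(ℝ, EuclideanSpace ℝ (Fin 2)) P.f x v = p.1 ∧ mlineDeriv (𝓡∂ 4) D.f x v = p.2 := by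
    intro x hx p
    have hxr : ‖P.f x‖ ≤ r := hΔ (P.f x) hx.1
    have hνx : 0 < mlineDeriv (𝓡∂ 4) D.f x (ν x) := hs₁ν x hxr (by
      have := hx.2; simp only [mem_setOf_eq] at this; linarith)
    -- a preimage of `p.1` under `df`
    obtain ⟨v₁, hv₁⟩ : ∃ v₁ : EuclideanSpace ℝ (Fin 4),
        mfderiv (𝓡∂ 4) 𝓘(ℝ, EuclideanSpace ℝ (Fin 2)) P.f x v₁ = p.1 := by
      rcases (𝓡∂ 4).isInteriorPoint_or_isBoundaryPoint x with hxi | hxb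
      · exact P.surjective_mfderiv_of_box hcrit hx.1 p.1
      · obtain ⟨v, -, hv⟩ := P.exists_tangent_preimage_of_box hΔ1 hx.1 hxb p.1
        exact ⟨v, hv⟩
    set L : EuclideanSpace ℝ (Fin 4) →L[ℝ] EuclideanSpace ℝ (Fin 2) :=
      mfderiv (𝓡∂ 4) 𝓘(ℝ, EuclideanSpace ℝ (Fin 2)) P.f x with hL
    set μ : ℝ := mlineDeriv (𝓡∂ 4) D.f x (ν x) with hμ
    set t : ℝ := (p.2 - mlineDeriv (𝓡∂ 4) D.f x v₁) / μ with ht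
    set ν' : EuclideanSpace ℝ (Fin 4) := ν x with hν'
    refine ⟨v₁ + t • ν', ?_, ?_⟩
    · have hk : L ν' = 0 := hνk x hxr
      have hv₁' : L v₁ = p.1 := hv₁
      show L (v₁ + t • ν') = p.1
      rw [map_add, map_smul, hv₁', hk, smul_zero, add_zero]
    · set Lσ : EuclideanSpace ℝ (Fin 4) →L[ℝ] ℝ := mfderiv (𝓡∂ 4) 𝓘(ℝ, ℝ) D.f x with hLσ
      have h1 : Lσ (v₁ + t • ν') = Lσ v₁ + t * Lσ ν' := by
        rw [map_add, map_smul, smul_eq_mul]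
      have h1' : mlineDeriv (𝓡∂ 4) D.f x (v₁ + t • ν') = Lσ (v₁ + t • ν') := rfl
      have h2 : Lσ ν' = μ := rfl
      have h3 : Lσ v₁ = mlineDeriv (𝓡∂ 4) D.f x v₁ := rfl
      rw [h1', h1, h2, h3, ht, div_mul_cancel₀ _ hνx.ne']
      ring
  -- the lifts
  have hlift : ∀ i : Fin 2, ∃ X : Π x : W, TangentSpace (𝓡∂ 4) x,
      ContMDiff (𝓡∂ 4) (𝓡∂ 4).tangent ∞ (fun x => (⟨x, X x⟩ : TangentBundle (𝓡∂ 4) W)) ∧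
      (∀ z ∈ (𝓡∂ 4).boundary W, halfSpaceCoord 3 (X z) = 0) ∧
      (∀ x ∈ C, mfderiv (𝓡∂ 4) 𝓘(ℝ, EuclideanSpace ℝ (Fin 2)) P.f x (X x) =
        EuclideanSpace.single i (1 : ℝ)) ∧
      ∀ x ∈ Dl, mlineDeriv (𝓡∂ 4) D.f x (X x) = 0 := fun i =>
    exists_contMDiff_lift_tangent_level (k := 3) P.contMDiff D.f_smooth hσb hCc hDlc inter_subset_left
      (fun x hx _ => P.surjective_mfderiv_of_box hcrit hx)
      (fun x hx hxb => P.exists_tangent_preimage_of_box hΔ1 hx hxb) hjoint _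
  choose X hXs hXt hXg hXσ using hlift
  obtain ⟨Φ, Ψ, hΦs, hΨs, hΦ0, hfib, hbox, hΦb, hΨb, hlev⟩ :=
    exists_trivialisation_of_fields (k := 3) P.contMDiff hδΔ hXs hXt (fun i x hx => hXg i x hx)
  have hlevσ := hlev D.f D.f_smooth (2 * s₀) (fun i x hx hxs =>
    hXσ i x ⟨fun j => (hx j).le, by simp only [mem_setOf_eq]; exact hxs.le⟩)
  refine ⟨s₀, hs₀pos, Φ, Ψ, hΦs, hΨs, hΦ0, hfib, hbox, hΦb, hΨb, fun y hy hys u hu => ?_,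
    fun x hx hxs => ?_⟩
  · exact hlevσ.1 y hy (by linarith) u hu
  · exact hlevσ.2 x hx (by linarith)

end PALF

end Literature.Geometry.Symplectic

end
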